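import Literature.AlgebraicTopology.Homotopy.StrongDeformationRetract
import Mathlib.Topology.Homeomorph.Lemmas
import HarnessLib

/-!
# Transporting strong deformation retractions to subspaces and along embeddings

Two book-keeping lemmas for the tree's notion
`Literature.AlgebraicTopology.Homotopy.IsStrongDeformationRetractOf A S` ("`A` is a strong
deformation retract of `S`", `A`, `S` subsets of a space `X`; Hatcher, *Algebraic Topology* (2002),
Ch. 0, p. 2), needed to move the radial deformation of a collar annulus of `∂Dⁿ` into a space in
which the disc `Dⁿ` is embedded (as in the proof of Hatcher's Prop. 2.22, or Milnor's Thm. 3.14 /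
Cor. 3.15 for the left-hand discs):

* `IsStrongDeformationRetractOf.preimage_val`: if `S ⊆ W`, the property passes to the traces
  `W ↓∩ A`, `W ↓∩ S` in the subspace `↥W` (the deformation stays inside `S ⊆ W`);
* `IsStrongDeformationRetractOf.image_of_isEmbedding`: the property passes to the images `f '' A`,
  `f '' S` under a topological embedding `f : X → Y` (a homeomorphism onto its image), possibly
  between spaces in different universes.

## References

* A. Hatcher, *Algebraic Topology*, CUP 2002, Ch. 0, p. 2 (deformation retractions). [HatcherAT2002]
-/

noncomputable section

open Set Function Topology
open scoped unitInterval

namespace Literature.AlgebraicTopology.Homotopy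

namespace IsStrongDeformationRetractOf

variable {X : Type*} [TopologicalSpace X] {A S : Set X}

/-- **Restriction to a subspace.**  If `A` is a strong deformation retract of `S` in `X` and
`S ⊆ W`, then `W ↓∩ A` is a strong deformation retract of `W ↓∩ S` in the subspace `↥W` (the same
deformation, which takes values in `S ⊆ W`). [cite: HatcherAT2002, Ch. 0, p. 2] -/
theorem preimage_val {W : Set X} (h : IsStrongDeformationRetractOf A S) (hSW : S ⊆ W) :
    IsStrongDeformationRetractOf (Subtype.val ⁻¹' A : Set ↥W) (Subtype.val ⁻¹' S : Set ↥W) := by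
  obtain ⟨H, h0, h1, hfix⟩ := h
  -- the identification of the trace of `S` on `W` with `S`
  let ι : ↥(Subtype.val ⁻¹' S : Set ↥W) → ↥S := fun w => ⟨w.1.1, w.2⟩
  have hι : Continuous ι := by fun_prop
  let H' : I × ↥(Subtype.val ⁻¹' S : Set ↥W) → ↥(Subtype.val ⁻¹' S : Set ↥W) := fun p =>
    ⟨⟨(H (p.1, ι p.2) : X), hSW (H (p.1, ι p.2)).2⟩, (H (p.1, ι p.2)).2⟩
  have hH' : Continuous H' := by
    have hc : Continuous fun p : I × ↥(Subtype.val ⁻¹' S : Set ↥W) => (H (p.1, ι p.2) : X) :=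
      continuous_subtype_val.comp (H.continuous.comp (continuous_fst.prodMk (hι.comp continuous_snd)))
    exact (hc.subtype_mk _).subtype_mk _
  refine ⟨⟨H', hH'⟩, fun w => ?_, fun w => ?_, fun t w hw => ?_⟩
  · apply Subtype.ext
    apply Subtype.ext
    show (H (0, ι w) : X) = (ι w : X)
    rw [h0]
  · exact h1 (ι w)
  · apply Subtype.ext
    apply Subtype.ext
    show (H (t, ι w) : X) = (ι w : X)
    rw [hfix t (ι w) hw]

/-- **Transport along an embedding.**  If `A` is a strong deformation retract of `S` in `X` and
`f : X → Y` is a topological embedding, then `f '' A` is a strong deformation retract of `f '' S`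
in `Y` (conjugate the deformation by the homeomorphism of `S` onto `f '' S`). [cite: HatcherAT2002, Ch. 0, p. 2] -/
theorem image_of_isEmbedding {Y : Type*} [TopologicalSpace Y] {f : X → Y} (hf : IsEmbedding f)
    (h : IsStrongDeformationRetractOf A S) : IsStrongDeformationRetractOf (f '' A) (f '' S) := by
  obtain ⟨H, h0, h1, hfix⟩ := h
  let e : X ≃ₜ ↥(range f) := hf.toHomeomorph
  have hfe : ∀ z : ↥(range f), f (e.symm z) = z := fun z => by
    rw [← hf.toHomeomorph_apply_coe (e.symm z)]
    exact congrArg Subtype.val (e.apply_symm_apply z)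
  have hef : ∀ x : X, e.symm ⟨f x, mem_range_self x⟩ = x := fun x => by
    apply hf.injective
    rw [hfe]
  -- the preimage point in `S` of a point of `f '' S`
  have hmem : ∀ y : ↥(f '' S), e.symm ⟨y.1, image_subset_range f S y.2⟩ ∈ S := fun y => by
    obtain ⟨x, hx, hxy⟩ := y.2
    have : e.symm ⟨y.1, image_subset_range f S y.2⟩ = x := by
      apply hf.injective
      rw [hfe, ← hxy]
    rw [this]
    exact hx
  let ι : ↥(f '' S) → ↥S := fun y => ⟨e.symm ⟨y.1, image_subset_range f S y.2⟩, hmem y⟩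
  have hι : Continuous ι :=
    (e.symm.continuous.comp (continuous_subtype_val.subtype_mk _)).subtype_mk _
  have hιf : ∀ y : ↥(f '' S), f (ι y) = y := fun y => hfe _
  let H' : I × ↥(f '' S) → ↥(f '' S) := fun p =>
    ⟨f (H (p.1, ι p.2)), mem_image_of_mem f (H (p.1, ι p.2)).2⟩
  have hH' : Continuous H' :=
    (hf.continuous.comp (continuous_subtype_val.comp
      (H.continuous.comp (continuous_fst.prodMk (hι.comp continuous_snd))))).subtype_mk _
  refine ⟨⟨H', hH'⟩, fun y => ?_, fun y => ?_, fun t y hy => ?_⟩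
  · exact Subtype.ext (show f (H (0, ι y)) = y by rw [h0, hιf])
  · exact mem_image_of_mem f (h1 (ι y))
  · have hyA : (ι y : X) ∈ A := by
      obtain ⟨a, ha, hay⟩ := hy
      have : (ι y : X) = a := hf.injective (by rw [hιf, ← hay])
      rw [this]
      exact ha
    exact Subtype.ext (show f (H (t, ι y)) = y by rw [hfix t (ι y) hyA, hιf])

end IsStrongDeformationRetractOf

end Literature.AlgebraicTopology.Homotopy
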